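import Literature.Analysis.OperatorTheory.EigenbasisSpectralProjection
import HarnessLib

/-!
# The perturbed resolvent as a canonical bounded operator: eigen-relation, diagonal form in any
# eigenbasis, and Lipschitz dependence on the perturbation

Topic `Literature/Analysis/OperatorTheory`; continues `DiagonalPerturbationEigenbasis.lean`, where
the resolvent `R = (1 + D B)⁻¹ D` of a diagonal operator `D = diag_e(r)` (`r_i = (d_i + c)⁻¹`, the
resolvent of the unperturbed `A₀ = diag(d)`) perturbed by a bounded self-adjoint `B` was produced
existentially. Here it is a **definition** (`pertResolvent`, Neumann series `Units.oneSub`), and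
we prove what is needed to treat a *family* of perturbations `B_ν` (e.g. `-ν² cos²θ` for the oblate
spheroidal operators, DRSR arXiv:1402.7034 §5.2.1) with eigenbases chosen independently for each
`ν`:

* `pertResolvent_key` (`R x + D B R x = D x`), `pertResolvent_unique` (the identity determines
  `R`);
* **`pertResolvent_basis_of_coeff`** — if a Hilbert basis `f` satisfies the coefficient
  eigen-equations of the tree (`f_j + D B f_j = μ_j D f_j`), then `R f_j = μ_j⁻¹ f_j`, so
  `R = diag_f(μ⁻¹)` (`pertResolvent_eq_diag`) — whence the spectral projections `specProj f …` of
  `EigenbasisSpectralProjection.lean` are functions of the canonical `R` alone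
  (`specProj_eq_of_coeff_eigenbasis`);
* `norm_pertResolvent_le` (`‖R‖ ≤ ‖D‖/(1 - ‖DB‖)`), the **second resolvent identity**
  `R_B - R_{B'} = R_B (B' - B) R_{B'}` (`pertResolvent_sub`) and the Lipschitz bound
  `‖R_B - R_{B'}‖ ≤ ‖R_B‖ ‖R_{B'}‖ ‖B - B'‖` (`norm_pertResolvent_sub_le`).

## References

* M. Reed, B. Simon, *Methods of Modern Mathematical Physics IV* (1978), Thm. XIII.64 (proof) and
  the second resolvent identity; *I* (1980), Thm. VII.2. [ReedSimonIV1978] [ReedSimonI1980]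
-/

noncomputable section

open Filter Topology Set ContinuousLinearMap
open scoped InnerProductSpace ComplexConjugate ENNReal

namespace Literature.Analysis.OperatorTheory

variable {ι : Type*} {𝕜 : Type*} [RCLike 𝕜]
variable {H : Type*} [NormedAddCommGroup H] [InnerProductSpace 𝕜 H] [CompleteSpace H]
variable (e : HilbertBasis ι 𝕜 H) {r : ι → 𝕜} {C : ℝ} (hr : ∀ i, ‖r i‖ ≤ C)

/-! ### The definition -/

omit [CompleteSpace H] in
/-- Smallness transported to `-(D B)`. [folklore] -/
theorem norm_neg_diag_comp_lt {B : H →L[𝕜] H} (hsmall : ‖basisDiag e r C hr ∘L B‖ < 1) :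
    ‖-(basisDiag e r C hr ∘L B)‖ < 1 := by rwa [norm_neg]

/-- **The perturbed resolvent `R_B = (1 + D B)⁻¹ D`**, `D = diag_e(r)`, for `‖D B‖ < 1`.
[cite: ReedSimonIV1978, Thm. XIII.64 (proof)] -/
def pertResolvent (B : H →L[𝕜] H) (hsmall : ‖basisDiag e r C hr ∘L B‖ < 1) : H →L[𝕜] H :=
  (↑(Units.oneSub (-(basisDiag e r C hr ∘L B)) (norm_neg_diag_comp_lt e hr hsmall))⁻¹ :
    H →L[𝕜] H) ∘L basisDiag e r C hr

variable {e hr} {B B' : H →L[𝕜] H}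

/-- The unit `1 + D B`. [folklore] -/
theorem val_oneSub_eq (hsmall : ‖basisDiag e r C hr ∘L B‖ < 1) :
    (↑(Units.oneSub (-(basisDiag e r C hr ∘L B)) (norm_neg_diag_comp_lt e hr hsmall)) :
      H →L[𝕜] H) = 1 + basisDiag e r C hr ∘L B := by
  rw [Units.val_oneSub, sub_neg_eq_add]

/-- `(1 + D B) ((1 + D B)⁻¹ y) = y`. [folklore] -/
theorem oneAdd_inv_apply (hsmall : ‖basisDiag e r C hr ∘L B‖ < 1) (y : H) :
    (1 + basisDiag e r C hr ∘L B) ((↑(Units.oneSub (-(basisDiag e r C hr ∘L B))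
      (norm_neg_diag_comp_lt e hr hsmall))⁻¹ : H →L[𝕜] H) y) = y := by
  have h := congrArg (fun T : H →L[𝕜] H ↦ T y)
    (Units.oneSub (-(basisDiag e r C hr ∘L B)) (norm_neg_diag_comp_lt e hr hsmall)).mul_inv
  rw [val_oneSub_eq hsmall] at h
  exact h

/-- **The key identity** `R x + D B R x = D x`. [cite: ReedSimonIV1978, Thm. XIII.64 (proof)] -/
theorem pertResolvent_key (hsmall : ‖basisDiag e r C hr ∘L B‖ < 1) (x : H) :
    pertResolvent e hr B hsmall x + basisDiag e r C hr (B (pertResolvent e hr B hsmall x)) =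
      basisDiag e r C hr x :=
  oneAdd_inv_apply hsmall (basisDiag e r C hr x)

/-- `1 + D B` is injective. [folklore] -/
theorem oneAdd_injective (hsmall : ‖basisDiag e r C hr ∘L B‖ < 1) :
    Function.Injective fun x : H ↦ x + basisDiag e r C hr (B x) := by
  intro x y hxy
  have h : (1 + basisDiag e r C hr ∘L B) x = (1 + basisDiag e r C hr ∘L B) y := hxy
  have hu := (Units.oneSub (-(basisDiag e r C hr ∘L B)) (norm_neg_diag_comp_lt e hr hsmall)).isUnit
  rw [val_oneSub_eq hsmall] at hu
  exact (ContinuousLinearMap.isUnit_iff_bijective.1 hu).1 h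

/-- **Uniqueness**: the key identity determines `R`. [folklore] -/
theorem pertResolvent_unique (hsmall : ‖basisDiag e r C hr ∘L B‖ < 1) {T : H →L[𝕜] H}
    (hT : ∀ x, T x + basisDiag e r C hr (B (T x)) = basisDiag e r C hr x) :
    T = pertResolvent e hr B hsmall := by
  ext x
  exact oneAdd_injective hsmall ((hT x).trans (pertResolvent_key hsmall x).symm)

/-! ### Eigenbases -/

/-- **Eigen-relation from the coefficient equations**: if `f_j + D B f_j = μ_j • D f_j` (the form in
which the tree records `(A₀ + B) f_j = λ_j f_j`, with `μ_j = λ_j + c`) and `μ_j ≠ 0`, then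
`R f_j = μ_j⁻¹ f_j`. [cite: ReedSimonIV1978, Thm. XIII.64 (proof)] -/
theorem pertResolvent_basis_of_coeff (hsmall : ‖basisDiag e r C hr ∘L B‖ < 1) {ι' : Type*}
    {f : ι' → H} {μ : ι' → 𝕜}
    (hf : ∀ j, f j + basisDiag e r C hr (B (f j)) = μ j • basisDiag e r C hr (f j))
    (hμ : ∀ j, μ j ≠ 0) (j : ι') :
    pertResolvent e hr B hsmall (f j) = (μ j)⁻¹ • f j := by
  -- both sides solve `y + D B y = D f_j`
  apply oneAdd_injective hsmall
  simp only
  rw [pertResolvent_key, map_smul, map_smul, ← smul_add, hf j, smul_smul, inv_mul_cancel₀ (hμ j),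
    one_smul]

/-- A bound for the inverse levels. [folklore] -/
theorem norm_inv_le_of_le {ι' : Type*} {μ : ι' → 𝕜} {μ₀ : ℝ} (hμ₀ : 0 < μ₀) (hμ : ∀ j, μ₀ ≤ ‖μ j‖)
    (j : ι') : ‖(μ j)⁻¹‖ ≤ μ₀⁻¹ := by
  rw [norm_inv]
  exact inv_anti₀ hμ₀ (hμ j)

/-- **`R = diag_f(μ⁻¹)` in any Hilbert basis `f` satisfying the coefficient eigen-equations.**
[cite: ReedSimonI1980, Thm. VII.2] -/
theorem pertResolvent_eq_diag (hsmall : ‖basisDiag e r C hr ∘L B‖ < 1) {ι' : Type*}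
    (f : HilbertBasis ι' 𝕜 H) {μ : ι' → 𝕜} {μ₀ : ℝ} (hμ₀ : 0 < μ₀) (hμ : ∀ j, μ₀ ≤ ‖μ j‖)
    (hf : ∀ j, f j + basisDiag e r C hr (B (f j)) = μ j • basisDiag e r C hr (f j)) :
    pertResolvent e hr B hsmall =
      basisDiag f (fun j ↦ (μ j)⁻¹) μ₀⁻¹ (norm_inv_le_of_le hμ₀ hμ) := by
  have hμ0 : ∀ j, μ j ≠ 0 := fun j h ↦ by
    have := hμ j; rw [h, norm_zero] at this; exact absurd this (not_le.2 hμ₀)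
  have hd : Dense (Submodule.span 𝕜 (Set.range f) : Set H) :=
    Submodule.dense_iff_topologicalClosure_eq_top.2 f.dense_span
  refine ContinuousLinearMap.ext_on hd ?_
  rintro _ ⟨j, rfl⟩
  rw [pertResolvent_basis_of_coeff hsmall hf hμ0 j, diag_basis]

/-- **Spectral projections are functions of `R` alone**: two Hilbert bases `f, f'` satisfying the
coefficient eigen-equations (levels `μ, μ'`, bounded away from `0`) give the same spectral
projections for every set of levels. [cite: ReedSimonI1980, Thm. VII.2] -/
theorem specProj_eq_of_coeff_eigenbasis (hsmall : ‖basisDiag e r C hr ∘L B‖ < 1) {ι' ι'' : Type*}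
    (f : HilbertBasis ι' 𝕜 H) (f' : HilbertBasis ι'' 𝕜 H) {μ : ι' → ℝ} {μ' : ι'' → ℝ} {μ₀ : ℝ}
    (hμ₀ : 0 < μ₀) (hμ : ∀ j, μ₀ ≤ ‖(μ j : 𝕜)‖) (hμ' : ∀ j, μ₀ ≤ ‖(μ' j : 𝕜)‖)
    (hf : ∀ j, f j + basisDiag e r C hr (B (f j)) = (μ j : 𝕜) • basisDiag e r C hr (f j))
    (hf' : ∀ j, f' j + basisDiag e r C hr (B (f' j)) = (μ' j : 𝕜) • basisDiag e r C hr (f' j))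
    (J : Set ℝ) :
    (specProj f (fun j ↦ (μ j)⁻¹) J : H →L[𝕜] H) = specProj f' (fun j ↦ (μ' j)⁻¹) J := by
  have hμ0' : ∀ j, (μ' j : 𝕜) ≠ 0 := fun j h ↦ by
    have := hμ' j; rw [h, norm_zero] at this; exact absurd this (not_le.2 hμ₀)
  -- `R = diag_f(μ⁻¹)`, and `f'` is an eigenbasis of `R`
  have hR := pertResolvent_eq_diag hsmall f hμ₀ hμ hf
  have hκb : ∀ j, ‖(((μ j)⁻¹ : ℝ) : 𝕜)‖ ≤ μ₀⁻¹ := fun j ↦ by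
    rw [RCLike.ofReal_inv]; exact norm_inv_le_of_le hμ₀ hμ j
  refine specProj_eq_of_eigenbasis f' (κ := fun j ↦ (μ j)⁻¹) (μ := fun j ↦ (μ' j)⁻¹)
    (Cκ := μ₀⁻¹) (hκ := hκb) (fun j ↦ ?_) J
  have h := pertResolvent_basis_of_coeff hsmall hf' hμ0' j
  rw [hR] at h
  refine f.ext_inner fun i ↦ ?_
  rw [inner_basis_diag, RCLike.ofReal_inv, RCLike.ofReal_inv, ← h, inner_basis_diag]

/-! ### Norm bounds and the second resolvent identity -/

/-- `‖(1 + D B)⁻¹‖ ≤ (1 - ‖D B‖)⁻¹` (Neumann series). [folklore] -/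
theorem norm_oneAdd_inv_le (hsmall : ‖basisDiag e r C hr ∘L B‖ < 1) :
    ‖(↑(Units.oneSub (-(basisDiag e r C hr ∘L B)) (norm_neg_diag_comp_lt e hr hsmall))⁻¹ :
      H →L[𝕜] H)‖ ≤ (1 - ‖basisDiag e r C hr ∘L B‖)⁻¹ := by
  have h := tsum_geometric_le_of_norm_lt_one _ (norm_neg_diag_comp_lt e hr hsmall)
  rw [norm_neg] at h
  have h1 : ‖(1 : H →L[𝕜] H)‖ ≤ 1 := ContinuousLinearMap.norm_id_le
  change ‖∑' n : ℕ, (-(basisDiag e r C hr ∘L B)) ^ n‖ ≤ _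
  linarith

/-- **`‖R‖ ≤ ‖D‖ / (1 - ‖D B‖)`.** [folklore] -/
theorem norm_pertResolvent_le (hsmall : ‖basisDiag e r C hr ∘L B‖ < 1) :
    ‖pertResolvent e hr B hsmall‖ ≤ ‖basisDiag e r C hr‖ / (1 - ‖basisDiag e r C hr ∘L B‖) := by
  rw [pertResolvent, div_eq_inv_mul]
  exact (opNorm_comp_le _ _).trans
    (mul_le_mul_of_nonneg_right (norm_oneAdd_inv_le hsmall) (norm_nonneg _))

/-- **Second resolvent identity**: `R_B - R_{B'} = R_B (B' - B) R_{B'}`.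
[cite: ReedSimonIV1978, Thm. XIII.64 (resolvent identities)] -/
theorem pertResolvent_sub (hsmall : ‖basisDiag e r C hr ∘L B‖ < 1)
    (hsmall' : ‖basisDiag e r C hr ∘L B'‖ < 1) (x : H) :
    pertResolvent e hr B hsmall x - pertResolvent e hr B' hsmall' x =
      pertResolvent e hr B hsmall ((B' - B) (pertResolvent e hr B' hsmall' x)) := by
  set R := pertResolvent e hr B hsmall with hR
  set R' := pertResolvent e hr B' hsmall' with hR'
  set D := basisDiag e r C hr with hD
  have e1 : R x + D (B (R x)) = D x := pertResolvent_key hsmall x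
  have e2 : R' x + D (B' (R' x)) = D x := pertResolvent_key hsmall' x
  have e3 : R ((B' - B) (R' x)) + D (B (R ((B' - B) (R' x)))) = D ((B' - B) (R' x)) :=
    pertResolvent_key hsmall _
  apply oneAdd_injective hsmall
  simp only
  rw [← hD, e3]
  have step : R x - R' x + D (B (R x - R' x)) = (R x + D (B (R x))) - (R' x + D (B (R' x))) := by
    rw [map_sub, map_sub]; abel
  rw [step, e1, _root_.sub_apply, map_sub, ← e2]
  abel

/-- **Lipschitz dependence on the perturbation**: `‖R_B - R_{B'}‖ ≤ ‖R_B‖ ‖R_{B'}‖ ‖B - B'‖`.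
[folklore] -/
theorem norm_pertResolvent_sub_le (hsmall : ‖basisDiag e r C hr ∘L B‖ < 1)
    (hsmall' : ‖basisDiag e r C hr ∘L B'‖ < 1) :
    ‖pertResolvent e hr B hsmall - pertResolvent e hr B' hsmall'‖ ≤
      ‖pertResolvent e hr B hsmall‖ * ‖pertResolvent e hr B' hsmall'‖ * ‖B - B'‖ := by
  have heq : pertResolvent e hr B hsmall - pertResolvent e hr B' hsmall' =
      pertResolvent e hr B hsmall ∘L (B' - B) ∘L pertResolvent e hr B' hsmall' := by
    ext x
    exact pertResolvent_sub hsmall hsmall' x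
  rw [heq]
  calc ‖pertResolvent e hr B hsmall ∘L (B' - B) ∘L pertResolvent e hr B' hsmall'‖
      ≤ ‖pertResolvent e hr B hsmall‖ * ‖(B' - B) ∘L pertResolvent e hr B' hsmall'‖ :=
        opNorm_comp_le _ _
    _ ≤ ‖pertResolvent e hr B hsmall‖ * (‖B' - B‖ * ‖pertResolvent e hr B' hsmall'‖) :=
        mul_le_mul_of_nonneg_left (opNorm_comp_le _ _) (norm_nonneg _)
    _ = ‖pertResolvent e hr B hsmall‖ * ‖pertResolvent e hr B' hsmall'‖ * ‖B - B'‖ := by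
        rw [norm_sub_rev]; ring

end Literature.Analysis.OperatorTheory
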